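import Mathlib
import Summits.Ventures.PercRepro.TriangleCapOneBelowWithin

/-!
# PercRepro — THE EQUALITY LOCUS ONE BELOW THE DIAGONAL AT SECOND ORDER, EVERY ROW `a ≥ 4`: a non-extremal
`K₄⁻`-free graph with `a (k − a) − 1` edges on `k ≥ 2a + 2` vertices attains the second-best value
`Σ_v d(v)² + (k − 2) + 2 (k − 2a − 1)(a − 1) = m k` iff it is `K_{a+1,k−a−1}` minus a `(k − 2a)`-star — EXCEPT at
`(11, 4, 1)`, where `K_{5,5}` with a vertex hung on an edge also attains it (p3, gen 44; part 197g)

The equality tracking of part 197b on the induction of part 196c at `r = 1` (pieces: part 197f): the cap makes `D`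
`a`-bipartite, hence extremal; the convexity is strict; a vertex of degree `a − 1` is strictly below for
`k ≥ 2a + 3` and at `k = 2a + 2` forces `D − z` to the envelope (`K_{a,a+1}`, contradiction), or has `D − z =
K_{a,k−1−a}` with its neighbours on the large side; a vertex of degree `a` has `D − z` extremal at `(k − 1, a, 1)`
(the neighbours on the large side) or at the second-best value there — by the locus at `k − 1` the family `B2`
(the neighbours of `z` on its `(a + 1)`-side, by degree for `k ≥ 2a + 4`, by `nbhd_one_side_of_full` at
`k = 2a + 3`) or, at `k = 12`, `a = 4`, the hung `K_{5,5}` — impossible (four neighbours of degree `6`); the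
cross-row deletion is tight only on the boundary `k + 1 + d = 3a + 2`, which at `a = 4`, `k = 11`, `d = 2` produces
the hung `K_{5,5}` (`one_cross_eq`). Kit j314272: `34,650 = 11 · 126 · 25` such graphs at `(11, 27)`. Axioms: standard.
-/

namespace PercRepro

namespace TriangleCap

namespace C047

open Finset

universe u

variable {V : Type*} [Fintype V] [DecidableEq V]

/-- **THE LOCUS ONE BELOW, EVERY VERTEX TYPE, BY INDUCTION ON `k`:** `K₄⁻`-free, `4 ≤ a`, `2a + 2 ≤ k`,
`m + 1 = a (k − a)`, non-extremal, `Σ_v d(v)² + (k − 2) + 2 (k − 2a − 1)(a − 1) = m k` ⇒ `D ⊆ K(A, Aᶜ)` with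
`|A| = a + 1` and a missing star, or `(a, k) = (4, 11)` and `D` is the hung `K_{5,5}`. -/
theorem one_below_locus_aux (a : ℕ) (ha : 4 ≤ a) (n : ℕ) :
    ∀ (W : Type u) [Fintype W] [DecidableEq W] (D : SimpleGraph W) [DecidableRel D.Adj], Fintype.card W = n →
      K4mFree D → 2 * a + 2 ≤ Fintype.card W → D.edgeFinset.card + 1 = a * (Fintype.card W - a) →
      ∑ v, deg D v * deg D v + (Fintype.card W - 2) ≠ D.edgeFinset.card * Fintype.card W →
      ∑ v, deg D v * deg D v + (Fintype.card W - 2) + 2 * (Fintype.card W - 2 * a - 1) * (a - 1) =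
        D.edgeFinset.card * Fintype.card W →
      (∃ (A : Finset W) (v : W), A.card = a + 1 ∧ BipSub D A ∧ MissingStar D A v) ∨
        (a = 4 ∧ Fintype.card W = 11 ∧ HungK55 D) := by
  refine Nat.strong_induction_on n ?_
  intro n ih W _ _ D _ hn hK hk hm hne heq
  have hA : (∃ A : Finset W, A.card = a + 1 ∧ BipSub D A) ∨ (a = 4 ∧ Fintype.card W = 11 ∧ HungK55 D) := by
    -- (A) a vertex at the cap makes `D` `a`-bipartite, hence extremal
    by_cases hx : ∃ x, deg D x + a = Fintype.card W
    · obtain ⟨x, hx⟩ := hx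
      obtain ⟨A, hAcard, hA⟩ := below_cap_gen D hK a 1 ha (by omega) (by omega) hm (by omega) (fun _ => by omega)
        x hx
      exact absurd (sum_deg_sq_eq_of_bipSub_one D A a hAcard hA hm (by omega)) hne
    push Not at hx
    have hcap : ∀ v, deg D v + a ≤ Fintype.card W := fun v =>
      deg_add_le_card_of_dense D hK a (by omega) (by omega)
        (cap_arith a (Fintype.card W) D.edgeFinset.card 1 (by omega) (by omega)
          (below_cap_arith a (Fintype.card W) D.edgeFinset.card 1 (by omega) hm)) v
    have hcap' : ∀ v, deg D v + a + 1 ≤ Fintype.card W := fun v => by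
      have h1 := hcap v
      have h2 := hx v
      omega
    -- (B) the convexity is strict
    by_cases hdeg : ∀ v, a + 1 ≤ deg D v
    · exfalso
      have h := one_convex_strict D a (by omega) hk hm hcap' hdeg
      omega
    push Not at hdeg
    obtain ⟨z, hz⟩ := hdeg
    rcases Nat.lt_or_ge (deg D z + 1) a with hz1 | hz2
    · -- (C) the cross-row case
      exact one_cross_eq D hK a ha hk hm hcap' z (by omega) heq
    rcases Nat.lt_or_ge (deg D z) a with hz3 | hz4
    · -- (D1) a vertex of degree `a − 1`
      left
      exact one_within_eq_minus D hK a ha hk hm hcap' z (by omega) hne heq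
    · -- (D2) a vertex of degree `a`, with the induction hypothesis
      left
      have hza : deg D z = a := by omega
      have hcard' := card_del z
      have hedges' := card_edges_del D z
      rw [hza] at hedges'
      have hm' : (del D z).edgeFinset.card + 1 = a * (Fintype.card {v : W // v ≠ z} - a) := by
        have e : Fintype.card {v : W // v ≠ z} = Fintype.card W - 1 := by omega
        rw [e]
        exact (one_within_edges a (Fintype.card W) D.edgeFinset.card (del D z).edgeFinset.card (by omega) hk
          hedges' hm).1
      exact one_within_eq_a D hK a ha hk hm hcap' z hza hne heq (fun h1 h2 h3 =>
        ih (Fintype.card {v : W // v ≠ z}) (by omega) {v : W // v ≠ z} (del D z) rfl (k4mFree_del D hK z) h1 hm'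
          h2 h3)
  rcases hA with ⟨A, hAcard, hA⟩ | h
  · left
    have hmA : D.edgeFinset.card + (Fintype.card W - 2 * a) = (a + 1) * (Fintype.card W - (a + 1)) := by
      have := below_bip_edges a 1 (Fintype.card W) D.edgeFinset.card hk hm
      have e : Fintype.card W - 2 * a - 1 + 1 = Fintype.card W - 2 * a := by omega
      rw [e] at this
      exact this
    have heq' : ∑ v, deg D v * deg D v + (Fintype.card W - 2 * a) *
        (Fintype.card W - 1 - (Fintype.card W - 2 * a)) = D.edgeFinset.card * Fintype.card W := by
      rw [← one_other_term a (Fintype.card W) (by omega) hk, ← add_assoc]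
      exact heq
    obtain ⟨v, hv⟩ := exists_missingStar_of_closed_form_eq D A hA (a + 1) (Fintype.card W - 2 * a) hAcard hmA
      (by omega) heq'
    exact ⟨A, v, hAcard, hA, hv⟩
  · exact Or.inr h

/-- **THE EQUALITY LOCUS ONE BELOW THE DIAGONAL AT SECOND ORDER, EVERY ROW `a ≥ 4`** (the cell `(11, 4, 1)` aside):
`K₄⁻`-free, `2a + 2 ≤ k`, `m + 1 = a (k − a)`, non-extremal, `Σ_v d(v)² + (k − 2) + 2 (k − 2a − 1)(a − 1) = m k` ⇒
`K_{a+1,k−a−1}` minus a `(k − 2a)`-star. -/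
theorem one_below_second_locus (D : SimpleGraph V) [DecidableRel D.Adj] (hK : K4mFree D) (a : ℕ) (ha : 4 ≤ a)
    (hk : 2 * a + 2 ≤ Fintype.card V) (hex : ¬ (a = 4 ∧ Fintype.card V = 11))
    (hm : D.edgeFinset.card + 1 = a * (Fintype.card V - a))
    (hne : ∑ v, deg D v * deg D v + (Fintype.card V - 2) ≠ D.edgeFinset.card * Fintype.card V)
    (heq : ∑ v, deg D v * deg D v + (Fintype.card V - 2) + 2 * (Fintype.card V - 2 * a - 1) * (a - 1) =
      D.edgeFinset.card * Fintype.card V) :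
    ∃ (A : Finset V) (v : V), A.card = a + 1 ∧ BipSub D A ∧ MissingStar D A v := by
  rcases one_below_locus_aux a ha (Fintype.card V) V D rfl hK hk hm hne heq with h | ⟨h1, h2, -⟩
  · exact h
  · exact absurd ⟨h1, h2⟩ hex

/-- **THE CELL `(11, 27)`:** the non-extremal `K₄⁻`-free graphs on `11` vertices with `27` edges at the second-best
value `276` are `K_{5,6}` minus a `3`-star or the hung `K_{5,5}`. -/
theorem one_below_second_locus_eleven (D : SimpleGraph V) [DecidableRel D.Adj] (hK : K4mFree D)
    (hk : Fintype.card V = 11) (hm : D.edgeFinset.card = 27) (heq : ∑ v, deg D v * deg D v = 276) :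
    (∃ (A : Finset V) (v : V), A.card = 5 ∧ BipSub D A ∧ MissingStar D A v) ∨ HungK55 D := by
  rcases one_below_locus_aux 4 (le_refl 4) (Fintype.card V) V D rfl hK (by omega) (by omega)
    (by rw [hk, hm]; omega) (by rw [hk, hm, heq]) with h | ⟨-, -, h⟩
  · exact Or.inl h
  · exact Or.inr h

/-- **THE SECOND-BEST MAXIMISERS ONE BELOW THE DIAGONAL, `Fin k`:** for `4 ≤ a`, `2a + 2 ≤ k`, `(a, k) ≠ (4, 11)`, a
non-extremal `K₄⁻`-free graph on `Fin k` with `a (k − a) − 1` edges attains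
`Σ_v d(v)² + (k − 2) + 2 (k − 2a − 1)(a − 1) = m k` iff it is `K_{a+1,k−a−1}` minus a `(k − 2a)`-star. -/
theorem one_below_second_best_maximisers (k a : ℕ) (ha : 4 ≤ a) (hk : 2 * a + 2 ≤ k) (hex : ¬ (a = 4 ∧ k = 11))
    (D : SimpleGraph (Fin k)) [DecidableRel D.Adj] (hK : K4mFree D) (hm : D.edgeFinset.card + 1 = a * (k - a))
    (hne : ∑ v, deg D v * deg D v + (k - 2) ≠ D.edgeFinset.card * k) :
    ∑ v, deg D v * deg D v + (k - 2) + 2 * (k - 2 * a - 1) * (a - 1) = D.edgeFinset.card * k ↔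
      ∃ (A : Finset (Fin k)) (v : Fin k), A.card = a + 1 ∧ BipSub D A ∧ MissingStar D A v := by
  have hcard : Fintype.card (Fin k) = k := Fintype.card_fin k
  constructor
  · intro heq
    exact one_below_second_locus D hK a ha (by omega) (by rw [hcard]; exact hex) (by rw [hcard]; exact hm)
      (by rw [hcard]; exact hne) (by rw [hcard]; exact heq)
  · rintro ⟨A, v, hAcard, hA, hv⟩
    have hmA : D.edgeFinset.card + (k - 2 * a) = (a + 1) * (k - (a + 1)) := by
      have := below_bip_edges a 1 k D.edgeFinset.card hk hm
      have e : k - 2 * a - 1 + 1 = k - 2 * a := by omega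
      rw [e] at this
      exact this
    have h := closed_form_eq_of_missingStar D A hA hv (a + 1) (k - 2 * a) hAcard (by rw [hcard]; exact hmA)
      (by rw [hcard]; omega)
    rw [hcard, ← one_other_term a k (by omega) hk, ← add_assoc] at h
    exact h

end C047

end TriangleCap

end PercRepro
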